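import Literature.MathematicalPhysics.QuantumFieldTheory.Balaban1983to89.B15Prop1IntrinsicOfRecord
import Literature.MathematicalPhysics.QuantumFieldTheory.Balaban1983to89.B15Eq177ValueInvarianceCoDiv

/-!
# `Balaban1983to89.B15Prop1IntrinsicAtCoPRecord` — [Balaban1989LargeFieldI] Prop. 1 p. 194 / [Balaban1989LargeFieldII] pp. 357–359: ★★★ PROPOSITION 1 [IV]
# WITH ITS ANALYTIC-EXTENSION CLAUSE AT THE v1.5 BACKGROUND OF RECORD `Node00.bgMSCoPOfRecord F 2 ν K k Ω` (RECORD 13 `CoP`: print's (1.7)∧(1.9)-class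
# minimiser behind `UbgOfRecord₁₃CoP`), FROM THE THREE ANALYTIC LETTERS (J1)∕(L2)∕(L3) AND STRUCTURE ONLY — the class invariance of
# `B15Prop1IntrinsicOfRecord`'s corollary DISCHARGED by `B15Eq177ValueInvarianceCoDiv.gaugeAct_mem_regMSCoPOfRecord`

statement-level skeleton of published theorems with citation tags; proofs where landed; nothing here is a claim about
the Yang–Mills mass gap

Cell pub-ymgap, HUMAN RULING D-0062 (Track A full width), seat `pub-ymgap-dag-n12-c` (R134 acceleration seat (a), strategy s1 of DAG node N12 = [B15];
generation g6, sixth product; LOCATED-181 — see `B15Eq177ValueInvariance`, `B15Prop1LocalLettersOfFun`, `B15Prop1IntrinsicOfFun`, `B15Prop1IntrinsicOfRecord`).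

TYPING (instance hygiene, the reason this is its own module).  The NODE 00 record modules imported through `B15Eq177ValueInvarianceCoDiv` carry the
global instance `B6Prop26ReachTransplant.instDecidableEqPBond : DecidableEq (PBond P j)`, while the N12∕s1 chain (p518722 and its (181)-free twins)
states the slice objects `GaugeSlice`∕`freeBonds`∕`rGrad`∕`sliceFn`∕`ιA`∕`anExt` and the `G₀` image over the CLASSICAL instance (`open Classical`).  The two
instances are propositionally equal (a subsingleton) but not definitionally.  DEVICE (no attribute touched, no instance declared): the theorem binds the
bond-decidability as an instance-implicit family `[hdec : ∀ j, DecidableEq (PBond (F.P K) j)]` — so a consumer's letters elaborate with WHATEVER instance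
its context carries — together with the propositional pin `hcl : hdec = fun _ a b => Classical.propDecidable (a = b)` (discharged by the consumer with
`Subsingleton.elim _ _`); the proof substitutes `hcl` and applies `B15Prop1IntrinsicOfRecord`'s corollary verbatim.

WHAT THIS FILE PROVES (no `sorry`, no definition, no `… : Prop` fact; axioms standard): ★★★
`exists_domain_prop1Printed_lfVarOn_std_su2_box_intrinsic_analytic_atCoPRecord` — `∃ a₁ > 0, B15.Prop1Printed (lfVarOn su2Chart fun i => InstOn.std
(Node00.bgMSCoPOfRecord F 2 ν K k Ω) M₁ (Z i) (Λ i) (k i) (M i) (a₁ i) (anExt … (rA i)))` from (J1) `hGj`, (L2) `hlead` + `hsm`∕`hγle`, (L3) `hJ`, `hk`,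
structure, and the instance pin `hcl`.

HONEST SCOPE.  Count-neutral; the three analytic letters are NODE 00's ([15] Thm 1 ∕ Prop. 9; [IV] p.193; [LF-II] pp.357–359) and are NOT proved here;
NOT a discharge of N12; nothing continuum ∕ OS ∕ mass-gap ∕ Clay.
-/

noncomputable section

open Set Finset Metric
open scoped BigOperators Matrix RealInnerProductSpace Real InnerProductSpace

namespace Literature.MathematicalPhysics.QuantumFieldTheory.Balaban1983to89.B15Prop1IntrinsicAtCoPRecord

open B15DeterminingSets GaugeField B16Sect1Backgrounds B15Prop1Carrier B8Eq17ClassAkV1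
open B15Prop1SliceTaylorCalculus B15Prop1LocalLettersOfFun B15Prop1IntrinsicOfFun B15Prop1IntrinsicOfRecord
open B15Prop1AnalyticExtClause (cplxVec cplxSlice anExt)
open B15Prop1ChartCalculusSU2 (E3)
open T4CubeChartGnomonic (SU2)
open B15Prop1ChartSU2 (su2Chart)
open B15Prop1SliceCoordinates (GaugeSlice ιA freeBonds)
open T4AxialGaugeSmallField (castSite boxPlaqs)
open B6BondElimination (unitVec)
open B16Eq18Proof (box)
open B15Extension193 (extend)
open B15ShellGauge193 (shellGauge)
open B5Bounds167Lattice (formDk ofRealCfg)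
open B14.Eq213DetSet B14.Eq216Concrete B15Sect1Instances B15Eq177GaugeInvariance B15Eq177ValueInvariance B15Eq177ValueInvarianceCoDiv
open Literature.MathematicalPhysics.QuantumFieldTheory.BalabanImbrieJaffe1984to88.BIJ85Eq453GaugeField
open T4Continuum

section Record

open Classical

/-- ★★★ **PROPOSITION 1 [IV] WITH ITS ANALYTIC-EXTENSION CLAUSE AT THE v1.5 BACKGROUND OF RECORD `bgMSCoPOfRecord F 2 ν K k Ω`** (`SU(2)`; the
class `regMSCoPOfRecord` = [15] (2) = [6] (1.7) ∧ (1.9) on the support of record — the background behind `Node00.UbgOfRecord₁₃CoP`): the record corollary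
`B15Prop1IntrinsicOfRecord.exists_domain_prop1Printed_lfVarOn_std_su2_box_intrinsic_analytic_ofRecord` with the class invariance DISCHARGED
(`B15Eq177ValueInvarianceCoDiv.gaugeAct_mem_regMSCoPOfRecord`, [15] p. 278 «the spaces … are invariant»).  WHAT A CONSUMER SUPPLIES: (J1) `hGj`, (L2) `hlead`
+ `hsm`∕`hγle`, (L3) `hJ` about print's function `A ∘ U_{k,Z}` at this background, `k i ≤ m + K`, and the structural box∕margin∕constant hypotheses —
nothing else. [cite: Balaban1989LargeFieldI, Prop. 1 (1.77)–(1.78) p.194 (incl. the last clause), p.193; Balaban1989LargeFieldII, (1.7)–(1.9) p.358,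
(1.11)–(1.13) p.359; Balaban1985Variational, (2) p.278, Prop. 9 p.309] -/
theorem exists_domain_prop1Printed_lfVarOn_std_su2_box_intrinsic_analytic_atCoPRecord {F : T4Family} (ν : Node00.Stage7Numerics)
    (Kt kr : ℕ) (Ω : ℕ → Set (Site (F.P Kt) 0)) (hd3 : 3 ≤ (F.P Kt).d) (h0 : 0 < (F.P Kt).d) {ι : Type}
    -- bond decidability: the consumer's instance, pinned propositionally to the chain's classical one (`hcl := Subsingleton.elim _ _`)
    [hdec : ∀ j, DecidableEq (PBond (F.P Kt) j)] (hcl : hdec = fun _ a b => Classical.propDecidable (a = b))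
    (M₁ : ℕ) (Z Λ : ι → Set (Site (F.P Kt) 0)) (k : ι → ℕ) (M : ι → ℝ) (hk : ∀ i, k i ≤ (F.P Kt).m + (F.P Kt).K)
    (eR : ι → ℝ) (heR : ∀ i, 0 < eR i)
    (T : ∀ i, Finset (PBond (F.P Kt) (k i)))
    (lo hi : ι → Fin (F.P Kt).d → ℤ) (n : ι → ℕ) (hn : ∀ i κ, hi i κ ≤ lo i κ + n i) (hN : ∀ i, n i + 2 < (F.P Kt).sitesPerDir (k i))
    (hbox : ∀ i, pts (k i) (Λ i) = (castSite '' Set.Icc (lo i) (hi i) : Set (Site (F.P Kt) (k i))))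
    (hZ : ∀ i, (boxPlaqs (lo i - 1) (hi i + 1) : Set (Plaq (F.P Kt) (k i))) ⊆ plaqsInside (pts (k i) (Z i)))
    (hTG0 : ∀ i, T i = (box (fun κ => (hi i κ - lo i κ + 1).toNat) (lo i)).image fun x =>
      (⟨castSite (x - unitVec ⟨0, h0⟩), ⟨0, h0⟩⟩ : PBond (F.P Kt) (k i)))
    (hN5 : ∀ i κ, ((hi i κ - lo i κ + 1).toNat : ℤ) + 5 < (F.P Kt).sitesPerDir (k i))
    (K : ι → ℕ) (hK1 : ∀ i, 1 ≤ K i) (hKn : ∀ i κ, (hi i κ - lo i κ + 1).toNat ≤ K i)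
    (ext : ∀ i, GaugeField (F.P Kt) (k i) SU2 → GaugeField (F.P Kt) (k i) SU2)
    (hext : ∀ i Vk, ext i Vk = extend (pts (k i) (Λ i)) (shellGauge Vk (lo i) (hi i)) Vk)
    (hlohi : ∀ i, lo i ≤ hi i)
    {γ cJ bx : ℝ} (hγ : 0 < γ) (hcJ : 0 ≤ cJ) (hbx : 0 ≤ bx)
    (hbxM : ∀ i, 12 * ((F.P Kt).d : ℝ) * ((n i : ℝ) + 2) ^ 2 ≤ bx * (M i) ^ 2)
    {Cerr R 𝓐 : ι → ℝ} (hM : ∀ i, 1 ≤ (M i)) (hR : ∀ i, 0 < R i) (h𝓐 : ∀ i, 0 ≤ 𝓐 i)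
    (n' : ι → ℕ) (hn' : ∀ i, 1 ≤ n' i)
    -- (J1) the JOINT holomorphic extension of print's function in the datum perturbation and the field
    (hGj : ∀ i Vk, PlaqSmallOn (plaqsInside (pts (k i) (Z i ∩ (Λ i)ᶜ))) (eR i) Vk →
      ∃ 𝒢 : VecField (F.P Kt) (k i) (EuclideanSpace ℂ (Fin 3)) × VecField (F.P Kt) (k i) (EuclideanSpace ℂ (Fin 3)) → ℂ,
        DifferentiableOn ℂ 𝒢 (ball 0 (R i)) ∧
        (∀ z ∈ ball (0 : VecField (F.P Kt) (k i) (EuclideanSpace ℂ (Fin 3)) × VecField (F.P Kt) (k i) (EuclideanSpace ℂ (Fin 3))) (R i), ‖𝒢 z‖ ≤ 𝓐 i) ∧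
        ∀ p B' : VecField (F.P Kt) (k i) E3, ‖p‖ < R i → ‖B'‖ < R i →
          𝒢 (cplxVec p, cplxVec B') =
            ((fun177std (Node00.bgMSCoPOfRecord F 2 ν Kt kr Ω) M₁ (Z i) (k i) (expMul su2Chart B' (ext i (expMul su2Chart p Vk))) : ℝ) : ℂ))
    -- (L2) (1.7)–(1.9) p.358 for the Hessian of the slice function at `0`
    (hlead : ∀ i Vk, PlaqSmallOn (plaqsInside (pts (k i) (Z i ∩ (Λ i)ᶜ))) (eR i) Vk →
      ∀ X : GaugeSlice (pts (k i) (Λ i)) (T i) E3,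
      |⟪X, (fderiv ℝ (rGrad (pts (k i) (Λ i)) (T i)
              (sliceFn (pts (k i) (Λ i)) (T i) (fun177std (Node00.bgMSCoPOfRecord F 2 ν Kt kr Ω) M₁ (Z i) (k i)) (ext i Vk))) 0) X⟫ -
          ∑ a : Fin 3, formDk (n' i) (fun _ : Fin (F.P Kt).d => (F.P Kt).sitesPerDir (k i))
            (ofRealCfg (fun _ : Fin (F.P Kt).d => (F.P Kt).sitesPerDir (k i)) fun j =>
              ιA (pts (k i) (Λ i)) (T i) X ⟨j.1, j.2⟩ a)| ≤ Cerr i * ‖X‖ ^ 2)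
    (hsm : ∀ i, Cerr i ≤ (4 / Real.pi ^ 2) ^ ((F.P Kt).d + 2) / (2 * (3 * (K i : ℝ) ^ 2 + 2 * (K i : ℝ) ^ 4)))
    (hγle : ∀ i, γ / (M i) ^ 5 ≤ (4 / Real.pi ^ 2) ^ ((F.P Kt).d + 2) / (2 * (3 * (K i : ℝ) ^ 2 + 2 * (K i : ℝ) ^ 4)))
    -- (L3) p.359: the gradient at `0` is small at regular data
    (hJ : ∀ i ε Vk, 0 < ε → ε ≤ eR i → PlaqSmallOn (plaqsInside (pts (k i) (Z i ∩ (Λ i)ᶜ))) ε Vk →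
      ‖rGrad (pts (k i) (Λ i)) (T i)
        (sliceFn (pts (k i) (Λ i)) (T i) (fun177std (Node00.bgMSCoPOfRecord F 2 ν Kt kr Ω) M₁ (Z i) (k i)) (ext i Vk)) 0‖ ≤ cJ * ε)
    : ∃ a₁ : ι → ℝ, (∀ i, 0 < a₁ i) ∧
      B15.Prop1Printed (lfVarOn su2Chart fun i => InstOn.std (Node00.bgMSCoPOfRecord F 2 ν Kt kr Ω) M₁ (Z i) (Λ i) (k i) (M i) (a₁ i)
        (anExt (pts (k i) (Λ i)) (T i) (fun177std (Node00.bgMSCoPOfRecord F 2 ν Kt kr Ω) M₁ (Z i) (k i)) (ext i)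
          (min (1 / 2) (min (R i / 8) (γ / (M i) ^ 5 * (R i / 2) ^ 2 / (48 * (4 * 𝓐 i / R i + 1))))))) := by
  subst hcl
  exact exists_domain_prop1Printed_lfVarOn_std_su2_box_intrinsic_analytic_ofRecord hd3 h0 (Node00.avOfRecord F 2 Kt)
    (gaugeAct_mem_regMSCoPOfRecord ν Kt kr Ω) M₁ Z Λ k M hk eR heR T lo hi n hn hN hbox hZ hTG0 hN5 K hK1 hKn ext hext hlohi hγ hcJ hbx
    hbxM hM hR h𝓐 n' hn' hGj hlead hsm hγle hJ

end Record

end Literature.MathematicalPhysics.QuantumFieldTheory.Balaban1983to89.B15Prop1IntrinsicAtCoPRecord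

end
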